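import Summits.CriticalPhenomena.CardyFormulaZ2.Theorems.CardyUniqueLimitCardyRigidityBootstrap
import Summits.CriticalPhenomena.CardyFormulaZ2.Theorems.CardyUniqueLimitCardyRigidityDefs
import Literature.Probability.RandomPlanarGeometry.SLECardyIto
import HarnessLib

/-!
# The far-field identities of a crossing-martingale kernel: vocabulary and the family bootstrap

Sub-problem `CriticalPhenomena/CardyFormulaZ2`; crux
`Summit.CriticalPhenomena.CardyFormulaZ2.Theses.CardyUniqueLimit.CardyRigidity`
(stmt-CriticalPhenomena-0746), line `crossing_martingale` (skeleton `Lines/crossing_martingale.lean`,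
definitions module `Theorems/CardyUniqueLimitCardyRigidityDefs.lean`), STUB C `stub_kernelAffineBeta`
("a crossing-martingale kernel is affine-beta", general continuous `f`).

STUB C splits as C = C2 ∘ C1 with the interface predicate `HasFarFieldIdentities f κ` of this file:

* **C1 (probability, the far-field expansion; NOT in this file).**  A regular driving process `W`
  whose level-stopped one-sided `f`-crossing observables are martingales satisfies
  `HasFarFieldIdentities f (E W₁²)`: put the marks at `R(ξ + θ𝟙)`, integrate the martingale
  identity `E f(η_{1∧ρ}) = f(η₀)` against a test function `ψ(θ) dθ`, and expand at order `R⁻²`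
  (the randomness enters only through the SHIFT `θ ↦ θ - W₁/R` up to `O(R⁻³)`, so no derivative
  of `f` is ever taken: `∫ f(η(ξ+θ𝟙-W/R 𝟙)) ψ(θ) dθ = ∫ f(η(ξ+θ𝟙)) ψ(θ + W/R) dθ`).
* **C2 (analysis, files `…FarFieldBase` + `…AffineBeta`).**  `HasFarFieldIdentities f κ` with `f`
  continuous on `(0,1)` forces `f = A·I_{2/3} + B`: the bootstrap of `…Bootstrap` makes
  `F = f ∘ η(ξ + ·𝟙)` constant (`κ = 0`) or `C²` with `κ F'' + 4(Σᵢ (ξᵢ+θ)⁻¹) F' = 0`; read at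
  `θ = 0` through the Möbius form `η(ξ+θ𝟙) = A(ξ₀+θ)/(ξ₁+θ)` this is the generator equation
  `κ(c₁² f'' + c₁' f') + 4(Σ ξᵢ⁻¹) c₁ f' = 0` at every configuration, and two configurations of
  one modulus give `(6-κ) f' = 0` and, at `κ = 6`, Cardy's equation `3η(1-η)f'' + 2(1-2η)f' = 0`.

This file: the predicate `HasFarFieldIdentities`; the Möbius calculus of the translated modulus
(`AffineBeta.cardyEta_shift`, `hasDerivAt_cardyEta_shift`, `cardyEta_shift_inv`); the solution of
Cardy's equation (`AffineBeta.affine_cardy_of_ode`: `f = A·F + B`, via `hasDerivAt_cardyDerivF`);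
the bootstrap on one translation family (`AffineBeta.family_bootstrap`, registered glue sub-goal
`farField_family_bootstrap`) and the standard base `(2η/(1+η), 1, 2)` of a modulus `η`
(`AffineBeta.standardBase`).

References: Cardy (1992), eq. (8); Lawler–Schramm–Werner (2001), §3; Werner (2007), §3.
-/

noncomputable section

open MeasureTheory Filter Set Topology
open scoped NNReal
open Literature.Probability.RandomPlanarGeometry

namespace Summit.CriticalPhenomena.CardyFormulaZ2.Cruxes.CardyRigidity.CrossingMartingale

/-! ### The far-field identities and the affine-beta conclusion -/

/-- **The far-field second-moment identities** of a kernel `f` with effective diffusivity `κ`: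
for all marks `0 < ξ₀ < ξ₁ < ξ₂` and every test function `ψ` of `(-ξ₀, ∞)`,
`κ ∫ f(η(ξ+θ)) ψ''(θ) dθ = ∫ f(η(ξ+θ)) (w_ξ ψ)'(θ) dθ` with the weight
`w_ξ(θ) = 4 Σᵢ (ξᵢ + θ)⁻¹`, where `η(ξ + θ) = cardyEta (ξ₀+θ) (ξ₁+θ) (ξ₂+θ)` is the modulus of
the translated marks seen from the tip `0`.  (This is what the far-field expansion at order
`R⁻²` of the level-stopped crossing martingales of a regular driving process with
`E W₁² = κ` yields; for `W = √κ B` it is the Itô drift identity integrated against `ψ`.)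
[cite: LawlerSchrammWerner2001, §3] -/
def HasFarFieldIdentities (f : ℝ → ℝ) (κ : ℝ) : Prop :=
  ∀ ξ : Fin 3 → ℝ, StrictMono ξ → 0 < ξ 0 →
    ∀ ψ : ℝ → ℝ, ContDiff ℝ (⊤ : ℕ∞) ψ → HasCompactSupport ψ → tsupport ψ ⊆ Ioi (-ξ 0) →
      κ * ∫ θ, f (cardyEta (ξ 0 + θ) (ξ 1 + θ) (ξ 2 + θ)) * deriv (deriv ψ) θ =
        ∫ θ, f (cardyEta (ξ 0 + θ) (ξ 1 + θ) (ξ 2 + θ)) *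
          deriv (fun θ ↦ 4 * ((ξ 0 + θ)⁻¹ + (ξ 1 + θ)⁻¹ + (ξ 2 + θ)⁻¹) * ψ θ) θ

namespace AffineBeta

/-! ### The modulus of the translated marks `θ ↦ η(ξ + θ)` is a Möbius function of `θ` -/

section Moebius

variable {a b c : ℝ}

/-- Closed form: `cardyEta (a+θ) (b+θ) (c+θ) = (a+θ)(c-b)/((b+θ)(c-a))`. [folklore] -/
theorem cardyEta_shift (a b c θ : ℝ) :
    cardyEta (a + θ) (b + θ) (c + θ) = (a + θ) * (c - b) / ((b + θ) * (c - a)) := by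
  rw [cardyEta_apply]
  have h1 : c + θ - (b + θ) = c - b := by ring
  have h2 : c + θ - (a + θ) = c - a := by ring
  rw [h1, h2]

/-- The `θ`-derivative of the translated modulus (`c ≠ a`, `b + θ ≠ 0`). [folklore] -/
theorem hasDerivAt_cardyEta_shift (hca : c - a ≠ 0) {θ : ℝ} (hbθ : b + θ ≠ 0) :
    HasDerivAt (fun θ ↦ cardyEta (a + θ) (b + θ) (c + θ))
      ((c - b) * (b - a) / ((c - a) * (b + θ) ^ 2)) θ := by
  have h1 : HasDerivAt (fun θ ↦ (a + θ) * (c - b) / ((b + θ) * (c - a)))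
      ((1 * (c - b) * ((b + θ) * (c - a)) - (a + θ) * (c - b) * (1 * (c - a))) /
        ((b + θ) * (c - a)) ^ 2) θ := by
    have hn : HasDerivAt (fun θ ↦ (a + θ) * (c - b)) (1 * (c - b)) θ :=
      ((hasDerivAt_id θ).const_add a).mul_const _
    have hd : HasDerivAt (fun θ ↦ (b + θ) * (c - a)) (1 * (c - a)) θ :=
      ((hasDerivAt_id θ).const_add b).mul_const _
    exact hn.div hd (mul_ne_zero hbθ hca)
  have h2 : (fun θ ↦ cardyEta (a + θ) (b + θ) (c + θ)) =
      fun θ ↦ (a + θ) * (c - b) / ((b + θ) * (c - a)) := funext fun θ ↦ cardyEta_shift a b c θ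
  rw [h2]
  refine h1.congr_deriv ?_
  field_simp
  ring

/-- The second `θ`-derivative of the translated modulus. [folklore] -/
theorem hasDerivAt_cardyEta_shift_deriv (hca : c - a ≠ 0) {θ : ℝ} (hbθ : b + θ ≠ 0) :
    HasDerivAt (fun θ ↦ (c - b) * (b - a) / ((c - a) * (b + θ) ^ 2))
      (-2 * ((c - b) * (b - a)) / ((c - a) * (b + θ) ^ 3)) θ := by
  have hd : HasDerivAt (fun θ ↦ (c - a) * (b + θ) ^ 2) ((c - a) * (2 * (b + θ) ^ 1 * 1)) θ :=
    (((hasDerivAt_id θ).const_add b).pow 2).const_mul _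
  have h1 := (hasDerivAt_const θ ((c - b) * (b - a))).div hd (mul_ne_zero hca (pow_ne_zero 2 hbθ))
  refine h1.congr_deriv ?_
  field_simp
  ring

/-- Möbius form of the translated modulus: `A (a+θ)/(b+θ)` with `A = (c-b)/(c-a)`. [folklore] -/
theorem cardyEta_shift' (hca : c - a ≠ 0) (θ : ℝ) :
    cardyEta (a + θ) (b + θ) (c + θ) = (c - b) / (c - a) * (a + θ) / (b + θ) := by
  rw [cardyEta_shift]
  rcases eq_or_ne (b + θ) 0 with h | h
  · simp [h]
  · field_simp

/-- Closed forms of `a + T`, `b + T` at the inverse shift `T = (A a - u b)/(u - A)`. [folklore] -/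
theorem shift_inv_formula (A a b u : ℝ) (hu : u - A ≠ 0) :
    a + (A * a - u * b) / (u - A) = u * (a - b) / (u - A) ∧
      b + (A * a - u * b) / (u - A) = A * (a - b) / (u - A) := by
  constructor <;> (field_simp; ring)

/-- The inverse Möbius map: with `A = (c-b)/(c-a) ≠ 0`, `a ≠ b` and `u ≠ A`, the shift
`T = (A a - u b)/(u - A)` has modulus `u`. [folklore] -/
theorem cardyEta_shift_inv (hca : c - a ≠ 0) (hcb : c - b ≠ 0) (hab : a ≠ b) {u : ℝ}
    (hu : u ≠ (c - b) / (c - a)) :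
    cardyEta (a + ((c - b) / (c - a) * a - u * b) / (u - (c - b) / (c - a)))
      (b + ((c - b) / (c - a) * a - u * b) / (u - (c - b) / (c - a)))
      (c + ((c - b) / (c - a) * a - u * b) / (u - (c - b) / (c - a))) = u := by
  rw [cardyEta_shift' hca]
  set A : ℝ := (c - b) / (c - a) with hA
  have hA0 : A ≠ 0 := div_ne_zero hcb hca
  have hu' : u - A ≠ 0 := sub_ne_zero.2 hu
  have hab' : a - b ≠ 0 := sub_ne_zero.2 hab
  obtain ⟨ha', hb'⟩ := shift_inv_formula A a b u hu'
  rw [ha', hb']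
  field_simp

end Moebius

/-! ### Solving Cardy's equation `3η(1-η) f'' + 2(1-2η) f' = 0` on `(0,1)` -/

/-- **Cardy's equation has only the affine-Cardy solutions.** If `f` is twice differentiable on
`(0,1)` with `3η(1-η) f'' + 2(1-2η) f' = 0`, then `f = A·F + B` on `(0,1)` with `F` Cardy's
function. [cite: Cardy1992, eq. (8)] -/
theorem affine_cardy_of_ode {f f₁ f₂ : ℝ → ℝ} (h₁ : ∀ η ∈ Ioo (0 : ℝ) 1, HasDerivAt f (f₁ η) η)
    (h₂ : ∀ η ∈ Ioo (0 : ℝ) 1, HasDerivAt f₁ (f₂ η) η)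
    (hode : ∀ η ∈ Ioo (0 : ℝ) 1, 3 * η * (1 - η) * f₂ η + 2 * (1 - 2 * η) * f₁ η = 0) :
    ∃ A B : ℝ, EqOn f (fun η ↦ A * cardyFunction η + B) (Ioo 0 1) := by
  -- `g = f₁ / F'` has zero derivative on `(0,1)`
  set g : ℝ → ℝ := fun η ↦ f₁ η / cardyDerivF η with hg
  have hg' : ∀ η ∈ Ioo (0 : ℝ) 1, HasDerivAt g 0 η := by
    intro η hη
    have hF := hasDerivAt_cardyDerivF hη
    have hFpos := cardyDerivF_pos hη
    have h := (h₂ η hη).div hF hFpos.ne'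
    refine h.congr_deriv ?_
    have hη0 : η ≠ 0 := hη.1.ne'
    have hη1 : 1 - η ≠ 0 := by linarith [hη.2]
    have hode' := hode η hη
    rw [div_eq_zero_iff]
    left
    have key : f₂ η * cardyDerivF η -
        f₁ η * (-(2 / 3) * (1 - 2 * η) / (η * (1 - η)) * cardyDerivF η) =
        cardyDerivF η / (3 * η * (1 - η)) *
          (3 * η * (1 - η) * f₂ η + 2 * (1 - 2 * η) * f₁ η) := by
      field_simp
      ring
    rw [key, hode', mul_zero]
  have one_half : (1 / 2 : ℝ) ∈ Ioo (0 : ℝ) 1 := ⟨by norm_num, by norm_num⟩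
  set A : ℝ := g (1 / 2) with hA
  have hgA : ∀ η ∈ Ioo (0 : ℝ) 1, g η = A := fun η hη ↦
    isOpen_Ioo.is_const_of_deriv_eq_zero isPreconnected_Ioo
      (fun x hx ↦ (hg' x hx).differentiableAt.differentiableWithinAt)
      (fun x hx ↦ (hg' x hx).deriv) hη one_half
  -- hence `f₁ = A F'` and `f - A F` has zero derivative
  have hf₁ : ∀ η ∈ Ioo (0 : ℝ) 1, f₁ η = A * cardyDerivF η := by
    intro η hη
    have := hgA η hη
    simp only [hg] at this
    rw [div_eq_iff (cardyDerivF_pos hη).ne'] at this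
    rw [this]
  set h : ℝ → ℝ := fun η ↦ f η - A * cardyFunction η with hh
  have hh' : ∀ η ∈ Ioo (0 : ℝ) 1, HasDerivAt h 0 η := by
    intro η hη
    have := (h₁ η hη).sub ((hasDerivAt_cardyFunction' hη).const_mul A)
    rw [hf₁ η hη, sub_self] at this
    exact this
  set B : ℝ := h (1 / 2) with hB
  refine ⟨A, B, fun η hη ↦ ?_⟩
  have := isOpen_Ioo.is_const_of_deriv_eq_zero isPreconnected_Ioo
      (fun x hx ↦ (hh' x hx).differentiableAt.differentiableWithinAt)
      (fun x hx ↦ (hh' x hx).deriv) hη one_half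
  simp only [hh] at this
  simp only [hB, hh]
  linarith

/-- Cardy's function is the beta law `I_{2/3}` on `(0,1)`. [cite: Cardy1992, eq. (8)] -/
theorem cardyFunction_eq_betaLaw {η : ℝ} (hη : η ∈ Ioo (0 : ℝ) 1) :
    cardyFunction η = betaLaw (2 / 3) η := by
  rw [betaLaw_two_thirds, cardyFunction_eq_incBeta13_div_holds η (Ioo_subset_Icc_self hη)]

end AffineBeta

namespace AffineBeta

/-! ### From the far-field identities to the bootstrap on each translation family -/

/-- Marks `0 < a < b < c` as a strictly increasing `Fin 3`-vector. [folklore] -/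
theorem strictMono_vec3 {a b c : ℝ} (hab : a < b) (hbc : b < c) : StrictMono ![a, b, c] := by
  refine Fin.strictMono_iff_lt_succ.2 fun i ↦ ?_
  fin_cases i
  · simpa using hab
  · simpa using hbc

/-- The translation family of the marks `(a, b, c)`: continuity of `θ ↦ f(η(a+θ, b+θ, c+θ))` on
`(-a, 1)` for `f` continuous on `(0,1)`. [folklore] -/
theorem continuousOn_comp_shift {f : ℝ → ℝ} (hf : ContinuousOn f (Ioo 0 1)) {a b c : ℝ}
    (hab : a < b) (hbc : b < c) :
    ContinuousOn (fun θ ↦ f (cardyEta (a + θ) (b + θ) (c + θ))) (Ioi (-a)) := by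
  have hca : c - a ≠ 0 := by linarith
  refine hf.comp (fun θ hθ ↦ ?_) (fun θ hθ ↦ ?_)
  · have hbθ : b + θ ≠ 0 := by simp only [mem_Ioi] at hθ; linarith
    exact (hasDerivAt_cardyEta_shift hca hbθ).continuousAt.continuousWithinAt
  · simp only [mem_Ioi] at hθ
    exact cardyEta_mem_Ioo (by linarith) (by linarith) (by linarith)

/-- **The bootstrap on one translation family.** [folklore] -/
theorem family_bootstrap {f : ℝ → ℝ} (hf : ContinuousOn f (Ioo 0 1)) {κ : ℝ}
    (h : HasFarFieldIdentities f κ) {a b c : ℝ} (ha : 0 < a) (hab : a < b) (hbc : b < c) :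
    (κ = 0 → ∃ C : ℝ, EqOn (fun θ ↦ f (cardyEta (a + θ) (b + θ) (c + θ))) (fun _ ↦ C)
      (Ioo (-a) 1)) ∧
    (κ ≠ 0 → ∃ F' F'' : ℝ → ℝ,
      (∀ θ ∈ Ioo (-a) 1, HasDerivAt (fun θ ↦ f (cardyEta (a + θ) (b + θ) (c + θ))) (F' θ) θ) ∧
      (∀ θ ∈ Ioo (-a) 1, HasDerivAt F' (F'' θ) θ) ∧
      ∀ θ ∈ Ioo (-a) 1, κ * F'' θ + 4 * ((a + θ)⁻¹ + (b + θ)⁻¹ + (c + θ)⁻¹) * F' θ = 0) := by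
  have hL : (-a : ℝ) < 1 := by linarith
  have hFc : ContinuousOn (fun θ ↦ f (cardyEta (a + θ) (b + θ) (c + θ))) (Ioo (-a) 1) :=
    (continuousOn_comp_shift hf hab hbc).mono Ioo_subset_Ioi_self
  -- the weight `w = 4 Σ (ξᵢ + θ)⁻¹` and its derivative
  set w : ℝ → ℝ := fun θ ↦ 4 * ((a + θ)⁻¹ + (b + θ)⁻¹ + (c + θ)⁻¹) with hw
  set w' : ℝ → ℝ := fun θ ↦
    4 * (-((a + θ) ^ 2)⁻¹ + -((b + θ) ^ 2)⁻¹ + -((c + θ) ^ 2)⁻¹) with hw'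
  have hpos : ∀ θ ∈ Ioo (-a) 1, 0 < a + θ ∧ 0 < b + θ ∧ 0 < c + θ := by
    intro θ hθ
    simp only [mem_Ioo] at hθ
    exact ⟨by linarith, by linarith, by linarith⟩
  have hinv : ∀ d θ : ℝ, 0 < d + θ → HasDerivAt (fun θ ↦ (d + θ)⁻¹) (-((d + θ) ^ 2)⁻¹) θ := by
    intro d θ hd
    have h2 : HasDerivAt (fun θ ↦ (d + θ)⁻¹) (-(1 : ℝ) / (d + θ) ^ 2) θ :=
      ((hasDerivAt_id' θ).const_add d).inv hd.ne'
    refine h2.congr_deriv ?_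
    rw [neg_div, one_div]
  have hwd : ∀ θ ∈ Ioo (-a) 1, HasDerivAt w (w' θ) θ := by
    intro θ hθ
    obtain ⟨h0, h1, h2⟩ := hpos θ hθ
    exact (((hinv a θ h0).add (hinv b θ h1)).add (hinv c θ h2)).const_mul 4
  have hw'c : ContinuousOn w' (Ioo (-a) 1) := by
    intro θ hθ
    obtain ⟨h0, h1, h2⟩ := hpos θ hθ
    have hc0 : ∀ d : ℝ, 0 < d + θ → ContinuousAt (fun θ ↦ -((d + θ) ^ 2)⁻¹) θ := by
      intro d hd
      refine ContinuousAt.neg (ContinuousAt.inv₀ ?_ (pow_ne_zero 2 hd.ne'))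
      exact ((continuous_const.add continuous_id).pow 2).continuousAt
    exact ((((hc0 a h0).add (hc0 b h1)).add (hc0 c h2)).const_mul 4).continuousWithinAt
  have hwpos : ∀ θ ∈ Ioo (-a) 1, 0 < w θ := by
    intro θ hθ
    obtain ⟨h0, h1, h2⟩ := hpos θ hθ
    simp only [hw]
    positivity
  -- the identity on test functions of `(-a, 1)`, from `HasFarFieldIdentities` at `ξ = (a,b,c)`
  have hid : ∀ ψ : ℝ → ℝ, ContDiff ℝ (⊤ : ℕ∞) ψ → HasCompactSupport ψ →
      tsupport ψ ⊆ Ioo (-a) 1 →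
      κ * ∫ θ, f (cardyEta (a + θ) (b + θ) (c + θ)) * deriv (deriv ψ) θ =
        ∫ θ, f (cardyEta (a + θ) (b + θ) (c + θ)) * deriv (fun θ ↦ w θ * ψ θ) θ := by
    intro ψ hψ hψc hψs
    have := h ![a, b, c] (strictMono_vec3 hab hbc) (by simpa using ha) ψ hψ hψc
      (by simpa using hψs.trans Ioo_subset_Ioi_self)
    simpa using this
  exact TestFunction.bootstrap hL hFc hwd hw'c hid |>.imp (fun h1 h0 ↦ h1 h0 hwpos) id

/-! ### The standard base of a modulus `η`: marks `(2η/(1+η), 1, 2)` -/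

/-- **Standard base.** For `η ∈ (0,1)` the marks `(a, 1, 2)`, `a = 2η/(1+η)`, have modulus `η`;
the inverse shift `T(u) = (A a - u)/(u - A)`, `A = (1+η)/2`, parametrises the moduli
`u ∈ (0, (1+3η)/4)` by shifts in `(-a, 1)`, smoothly. [folklore] -/
theorem standardBase {η : ℝ} (hη : η ∈ Ioo (0 : ℝ) 1) :
    ∃ a A : ℝ, 0 < a ∧ a < 1 ∧ 0 < A ∧ A * a = η ∧ (1 + 3 * η) / 4 < A ∧ η < (1 + 3 * η) / 4 ∧
      cardyEta (a + 0) (1 + 0) (2 + 0) = η ∧ (A * a - η * 1) / (η - A) = 0 ∧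
      (∀ u ∈ Ioo (0 : ℝ) ((1 + 3 * η) / 4),
        (A * a - u * 1) / (u - A) ∈ Ioo (-a) 1 ∧
        cardyEta (a + (A * a - u * 1) / (u - A)) (1 + (A * a - u * 1) / (u - A))
          (2 + (A * a - u * 1) / (u - A)) = u ∧
        HasDerivAt (fun u ↦ (A * a - u * 1) / (u - A)) (A * (1 - a) / (u - A) ^ 2) u) := by
  obtain ⟨hη0, hη1⟩ := hη
  have h1η : (1 + η) ≠ 0 := by linarith
  set a : ℝ := 2 * η / (1 + η) with ha
  set A : ℝ := (1 + η) / 2 with hA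
  have ha0 : 0 < a := by rw [ha]; positivity
  have ha1 : a < 1 := by rw [ha, div_lt_one (by linarith)]; linarith
  have hA0 : 0 < A := by rw [hA]; linarith
  have hAa : A * a = η := by rw [hA, ha]; field_simp
  have hA' : A = (2 - 1) / (2 - a) := by
    rw [hA, ha]
    have h2 : (2 : ℝ) - 2 * η / (1 + η) = 2 / (1 + η) := by field_simp; ring
    rw [h2]
    field_simp
    norm_num
  have hηA : (1 + 3 * η) / 4 < A := by rw [hA]; linarith
  refine ⟨a, A, ha0, ha1, hA0, hAa, hηA, by linarith, ?_, ?_, fun u hu ↦ ?_⟩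
  · simp only [add_zero]
    rw [cardyEta_apply, ha]
    have h2 : (2 : ℝ) - 2 * η / (1 + η) = 2 / (1 + η) := by field_simp; ring
    rw [h2]
    field_simp
    norm_num
  · rw [hAa]; simp
  obtain ⟨hu0, hu1⟩ := hu
  have huA : u - A ≠ 0 := by linarith
  have huA' : u - A < 0 := by linarith
  obtain ⟨hTa, hTb⟩ := shift_inv_formula A a 1 u huA
  refine ⟨⟨?_, ?_⟩, ?_, ?_⟩
  · -- `-a < T` iff `0 < a + T = u (a - 1)/(u - A)`
    have : 0 < a + (A * a - u * 1) / (u - A) := by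
      rw [hTa]
      exact div_pos_of_neg_of_neg (mul_neg_of_pos_of_neg hu0 (by linarith)) huA'
    linarith
  · -- `T < 1` iff `0 < 1 - T = (2u - A(1+a))/(u - A)`
    have hAa1 : A * (1 + a) = (1 + 3 * η) / 2 := by
      rw [mul_add, mul_one, hAa, hA]; ring
    have : 0 < 1 - (A * a - u * 1) / (u - A) := by
      have : 1 - (A * a - u * 1) / (u - A) = (2 * u - A * (1 + a)) / (u - A) := by
        field_simp; ring
      rw [this, hAa1]
      exact div_pos_of_neg_of_neg (by linarith) huA'
    linarith
  · have hca : (2 : ℝ) - a ≠ 0 := by linarith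
    have hcb : (2 : ℝ) - 1 ≠ 0 := by norm_num
    have hab : a ≠ 1 := ha1.ne
    have hu' : u ≠ (2 - 1) / (2 - a) := by rw [← hA']; intro h; exact huA (by rw [h, sub_self])
    have key := cardyEta_shift_inv hca hcb hab hu'
    rw [← hA'] at key
    exact key
  · have h1 : HasDerivAt (fun u ↦ (A * a - u * 1) / (u - A))
        (((0 - 1 * 1) * (u - A) - (A * a - u * 1) * 1) / (u - A) ^ 2) u :=
      (((hasDerivAt_const u (A * a)).sub ((hasDerivAt_id' u).mul_const 1)).div
        ((hasDerivAt_id' u).sub_const A) huA)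
    refine h1.congr_deriv ?_
    ring

end AffineBeta

/-- **The bootstrap on one translation family** (registered glue sub-goal of
stmt-CriticalPhenomena-0746, STUB C): under `HasFarFieldIdentities f κ`, for marks `0 < a < b < c`
the function `θ ↦ f(η(a+θ, b+θ, c+θ))` is constant on `(-a, 1)` if `κ = 0`, and `C²` there with
`κ F'' + 4(Σ (ξᵢ+θ)⁻¹) F' = 0` if `κ ≠ 0`. [cite: LawlerSchrammWerner2001, §3] -/
theorem farField_family_bootstrap : ∀ {f : ℝ → ℝ}, ContinuousOn f (Ioo 0 1) → ∀ {κ : ℝ}, HasFarFieldIdentities f κ → ∀ {a b c : ℝ}, 0 < a → a < b → b < c → (κ = 0 → ∃ C : ℝ, EqOn (fun θ ↦ f (cardyEta (a + θ) (b + θ) (c + θ))) (fun _ ↦ C) (Ioo (-a) 1)) ∧ (κ ≠ 0 → ∃ F' F'' : ℝ → ℝ, (∀ θ ∈ Ioo (-a) 1, HasDerivAt (fun θ ↦ f (cardyEta (a + θ) (b + θ) (c + θ))) (F' θ) θ) ∧ (∀ θ ∈ Ioo (-a) 1, HasDerivAt F' (F'' θ) θ) ∧ ∀ θ ∈ Ioo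 (-a) 1, κ * F'' θ + 4 * ((a + θ)⁻¹ + (b + θ)⁻¹ + (c + θ)⁻¹) * F' θ = 0) :=
  fun hf _ h _ _ _ ha hab hbc ↦ AffineBeta.family_bootstrap hf h ha hab hbc

end Summit.CriticalPhenomena.CardyFormulaZ2.Cruxes.CardyRigidity.CrossingMartingale

end
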